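import Mathlib
import Summits.CriticalPhenomena.PercolationContinuityZ3.Theorems.PercNearOneGluingNearOneGluingKnLemma3i
import HarnessLib

/-!
# `NoHeavyLowerTail` (stmt-CriticalPhenomena-4575), line fat-minority-linear — the RESTRICTED
# (two-sided) Kozma–Nitzan Lemma 3

Route task `nh-dp-fatminority` (gen 8).  `μ = prodBernoulli w` on the pairs of `Fin n`.

Kozma–Nitzan's Lemma 3 (arXiv:2401.12397, p. 6) transports a comparison `μ(a ↔ b) ≤ μ(c ↔ b)`
through conditioning on ONE event: an increasing event `E` determined by the open edge cluster of
the winner `c` (part (i)), or a decreasing event `Q` determined by the open edge cluster of the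
loser `a` (part (ii)).  Both parts can be imposed SIMULTANEOUSLY:

  `μ(D) · ( μ({a ↔ b} ∩ E ∩ Q) − μ({c ↔ b} ∩ E ∩ Q) ) ≤ μ(D ∩ E ∩ Q) · ( μ(a ↔ b) − μ(c ↔ b) )`,
  `D = {a ↮ c}`                                                          (`restrictedLemma3`),

for `E` increasing and determined by `C_c`, `Q` decreasing and determined by `C_a`, whatever the
sign of `μ(a ↔ b) − μ(c ↔ b)`.  In particular `μ(a ↔ b) ≤ μ(c ↔ b)` gives
`μ({a ↔ b} ∩ E ∩ Q) ≤ μ({c ↔ b} ∩ E ∩ Q)` (`restrictedLemma3_of_le`).  The proof is the proof of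
`signedLemma3i` with van den Berg–Häggström–Kahn's Theorem 1.5 (functions of `(C_c, C_a)`
increasing in `C_c` and decreasing in `C_a` are positively associated given `{c ↮ a}`; tree:
`BHK2006_twoClusterConditionalAssociation_holds`) in place of Theorems 1.3/1.4: the test function
`1_E · 1_Q` is increasing in `C_c` and decreasing in `C_a`.

Use (FINDINGS-fat-minority-gen8.md): with `E = {all edges of the observer block to B open}` and
`Q = {a ↮ y}` this is the restricted form of Kozma–Nitzan's Lemma 5 behind the exact two-unit
identity `−M₂ = D_x + E_x − π^x_∅ M₁` for Question 9 at depth 2.  No new definitions.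
-/

namespace Summit.CriticalPhenomena.PercolationContinuityZ3.Theorems

open MeasureTheory Set
open Literature.Probability.LatticeModels (prodBernoulli)
open Literature.Probability.Percolation (BondConfig openConn openEdgeCluster)

noncomputable section
open Classical
open Literature.Probability.LatticeModels Literature.Probability.Percolation

variable {n : ℕ}

/-- For `Q` decreasing and determined by the open edge cluster `C_s`, the indicator of the
down-closure `{C | ∃ ω ∈ Q, C ⊆ C_s ω}` evaluated at `C_s ω` is `1_Q ω`. [folklore] -/
theorem rl3_indicator_downClosure_openEdgeCluster {V : Type*} {Q : Set (BondConfig V)} {s : V}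
    (hQ : ∀ ω ω', ω ∈ Q → openEdgeCluster ω' s ⊆ openEdgeCluster ω s → ω' ∈ Q)
    (ω : BondConfig V) :
    {C : Set (Sym2 V) | ∃ ω' ∈ Q, C ⊆ openEdgeCluster ω' s}.indicator (1 : Set (Sym2 V) → ℝ)
        (openEdgeCluster ω s) = Q.indicator 1 ω := by
  by_cases hω : ω ∈ Q
  · have h1 : openEdgeCluster ω s ∈ {C : Set (Sym2 V) | ∃ ω' ∈ Q, C ⊆ openEdgeCluster ω' s} :=
      ⟨ω, hω, subset_rfl⟩
    rw [indicator_of_mem h1, indicator_of_mem hω, Pi.one_apply, Pi.one_apply]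
  · have h1 : openEdgeCluster ω s ∉ {C : Set (Sym2 V) | ∃ ω' ∈ Q, C ⊆ openEdgeCluster ω' s} := by
      rintro ⟨ω', hω', hsub⟩
      exact hω (hQ ω' ω hω' hsub)
    rw [indicator_of_notMem h1, indicator_of_notMem hω]

/-- The indicator of the down-closure `{C | ∃ ω ∈ Q, C ⊆ C_s ω}` is a decreasing function of the
set of edges. [folklore] -/
theorem rl3_antitone_indicator_downClosure {V : Type*} (Q : Set (BondConfig V)) (s : V) :
    Antitone ({C : Set (Sym2 V) | ∃ ω ∈ Q, C ⊆ openEdgeCluster ω s}.indicator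
      (1 : Set (Sym2 V) → ℝ)) := by
  intro C C' hCC'
  by_cases h : C' ∈ {C : Set (Sym2 V) | ∃ ω ∈ Q, C ⊆ openEdgeCluster ω s}
  · obtain ⟨ω, hω, hsub⟩ := h
    have h1 : C' ∈ {C : Set (Sym2 V) | ∃ ω ∈ Q, C ⊆ openEdgeCluster ω s} := ⟨ω, hω, hsub⟩
    have h2 : C ∈ {C : Set (Sym2 V) | ∃ ω ∈ Q, C ⊆ openEdgeCluster ω s} :=
      ⟨ω, hω, hCC'.trans hsub⟩
    rw [indicator_of_mem h1, indicator_of_mem h2, Pi.one_apply, Pi.one_apply]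
  · rw [indicator_of_notMem h]
    exact indicator_nonneg (fun _ _ => zero_le_one) _

/-- **BHK 2006 Thm 1.5 with `f = 1{c ↔ b}`, `g = 1_E · 1_Q`** (`E` increasing in `C_c`, `Q`
decreasing in `C_a`): `μ(D ∩ {c↔b}) μ(D ∩ (E ∩ Q)) ≤ μ(D) μ(D ∩ ({c↔b} ∩ (E ∩ Q)))`, `D = {c ↮ a}`.
[cite: VandenbergHaggstromKahn2005, Thm. 1.5 (p. 7, eq. (9))] -/
theorem rl3_winner (w : Sym2 (Fin n) → unitInterval) (c a b : Fin n)
    (E Q : Set (BondConfig (Fin n)))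
    (hE : ∀ ω ω', ω ∈ E → openEdgeCluster ω c ⊆ openEdgeCluster ω' c → ω' ∈ E)
    (hQ : ∀ ω ω', ω ∈ Q → openEdgeCluster ω' a ⊆ openEdgeCluster ω a → ω' ∈ Q) (hca : c ≠ a) :
    (prodBernoulli w).real ((openConn c a)ᶜ ∩ openConn c b) *
        (prodBernoulli w).real ((openConn c a)ᶜ ∩ (E ∩ Q)) ≤
      (prodBernoulli w).real (openConn c a)ᶜ *
        (prodBernoulli w).real ((openConn c a)ᶜ ∩ (openConn c b ∩ (E ∩ Q))) := by
  set SE : Set (Set (Sym2 (Fin n))) := {C | ∃ ω ∈ E, openEdgeCluster ω c ⊆ C} with hSE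
  set SQ : Set (Set (Sym2 (Fin n))) := {C | ∃ ω ∈ Q, C ⊆ openEdgeCluster ω a} with hSQ
  have hGE : Monotone (SE.indicator (1 : Set (Sym2 (Fin n)) → ℝ)) :=
    knLemma3i_monotone_indicator_upClosure E c
  have hGQ : Antitone (SQ.indicator (1 : Set (Sym2 (Fin n)) → ℝ)) :=
    rl3_antitone_indicator_downClosure Q a
  have hGEnn : ∀ C, 0 ≤ SE.indicator (1 : Set (Sym2 (Fin n)) → ℝ) C :=
    fun C => indicator_nonneg (fun _ _ => zero_le_one) C
  have hGQnn : ∀ C, 0 ≤ SQ.indicator (1 : Set (Sym2 (Fin n)) → ℝ) C :=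
    fun C => indicator_nonneg (fun _ _ => zero_le_one) C
  have key := BHK2006_twoClusterConditionalAssociation_holds (Fin n) w c a
    (fun C _ => connIndicatorFn c b C)
    (fun C D => SE.indicator (1 : Set (Sym2 (Fin n)) → ℝ) C * SQ.indicator 1 D)
    (fun _ => monotone_connIndicatorFn c b) (fun _ => antitone_const)
    (fun D => (hGE.mul_const (hGQnn D))) (fun C => (hGQ.const_mul (hGEnn C))) hca
  have hD : {ω : BondConfig (Fin n) | ¬ (openGraph ω).Reachable c a} = (openConn c a)ᶜ := rfl
  have hma : MeasurableSet (openConn c b : Set (BondConfig (Fin n))) :=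
    measurableSet_openConn_holds c b
  have hmEQ : MeasurableSet (E ∩ Q : Set (BondConfig (Fin n))) := MeasurableSet.of_discrete
  have hg : ∀ ω : BondConfig (Fin n),
      SE.indicator (1 : Set (Sym2 (Fin n)) → ℝ) (openEdgeCluster ω c) *
          SQ.indicator 1 (openEdgeCluster ω a) = (E ∩ Q).indicator 1 ω := by
    intro ω
    rw [hSE, hSQ, knLemma3i_indicator_upClosure_openEdgeCluster hE ω,
      rl3_indicator_downClosure_openEdgeCluster hQ ω]
    exact (congrFun (Set.inter_indicator_one (s := E) (t := Q) (M₀ := ℝ)) ω).symm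
  simp only [connIndicatorFn_openEdgeCluster, hg, hD] at key
  rw [show (fun ω : BondConfig (Fin n) => (openConn c b).indicator (1 : BondConfig (Fin n) → ℝ) ω *
        (E ∩ Q).indicator 1 ω) = (openConn c b ∩ (E ∩ Q)).indicator 1 from
      funext fun ω => (congrFun (Set.inter_indicator_one (s := openConn c b)
        (t := E ∩ Q) (M₀ := ℝ)) ω).symm] at key
  rw [setIntegral_indicator (hma.inter hmEQ), setIntegral_indicator hma,
    setIntegral_indicator hmEQ] at key
  simpa only [Pi.one_apply, setIntegral_const, smul_eq_mul, mul_one] using key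

/-- **BHK 2006 Thm 1.5 with `f = −1{a ↔ b}`, `g = 1_E · 1_Q`** (`E` increasing in `C_c`, `Q`
decreasing in `C_a`): `μ(D) μ(D ∩ ({a↔b} ∩ (E ∩ Q))) ≤ μ(D ∩ {a↔b}) μ(D ∩ (E ∩ Q))`,
`D = {c ↮ a}`. [cite: VandenbergHaggstromKahn2005, Thm. 1.5 (p. 7, eq. (9))] -/
theorem rl3_loser (w : Sym2 (Fin n) → unitInterval) (c a b : Fin n)
    (E Q : Set (BondConfig (Fin n)))
    (hE : ∀ ω ω', ω ∈ E → openEdgeCluster ω c ⊆ openEdgeCluster ω' c → ω' ∈ E)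
    (hQ : ∀ ω ω', ω ∈ Q → openEdgeCluster ω' a ⊆ openEdgeCluster ω a → ω' ∈ Q) (hca : c ≠ a) :
    (prodBernoulli w).real (openConn c a)ᶜ *
        (prodBernoulli w).real ((openConn c a)ᶜ ∩ (openConn a b ∩ (E ∩ Q))) ≤
      (prodBernoulli w).real ((openConn c a)ᶜ ∩ openConn a b) *
        (prodBernoulli w).real ((openConn c a)ᶜ ∩ (E ∩ Q)) := by
  set SE : Set (Set (Sym2 (Fin n))) := {C | ∃ ω ∈ E, openEdgeCluster ω c ⊆ C} with hSE
  set SQ : Set (Set (Sym2 (Fin n))) := {C | ∃ ω ∈ Q, C ⊆ openEdgeCluster ω a} with hSQ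
  have hGE : Monotone (SE.indicator (1 : Set (Sym2 (Fin n)) → ℝ)) :=
    knLemma3i_monotone_indicator_upClosure E c
  have hGQ : Antitone (SQ.indicator (1 : Set (Sym2 (Fin n)) → ℝ)) :=
    rl3_antitone_indicator_downClosure Q a
  have hGEnn : ∀ C, 0 ≤ SE.indicator (1 : Set (Sym2 (Fin n)) → ℝ) C :=
    fun C => indicator_nonneg (fun _ _ => zero_le_one) C
  have hGQnn : ∀ C, 0 ≤ SQ.indicator (1 : Set (Sym2 (Fin n)) → ℝ) C :=
    fun C => indicator_nonneg (fun _ _ => zero_le_one) C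
  have hFanti : ∀ C : Set (Sym2 (Fin n)), Antitone fun D : Set (Sym2 (Fin n)) => -connIndicatorFn a b D :=
    fun _ => (monotone_connIndicatorFn a b).neg
  have key := BHK2006_twoClusterConditionalAssociation_holds (Fin n) w c a
    (fun _ D => -connIndicatorFn a b D)
    (fun C D => SE.indicator (1 : Set (Sym2 (Fin n)) → ℝ) C * SQ.indicator 1 D)
    (fun _ => monotone_const) hFanti
    (fun D => (hGE.mul_const (hGQnn D))) (fun C => (hGQ.const_mul (hGEnn C))) hca
  have hD : {ω : BondConfig (Fin n) | ¬ (openGraph ω).Reachable c a} = (openConn c a)ᶜ := rfl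
  have hma : MeasurableSet (openConn a b : Set (BondConfig (Fin n))) :=
    measurableSet_openConn_holds a b
  have hmEQ : MeasurableSet (E ∩ Q : Set (BondConfig (Fin n))) := MeasurableSet.of_discrete
  have hg : ∀ ω : BondConfig (Fin n),
      SE.indicator (1 : Set (Sym2 (Fin n)) → ℝ) (openEdgeCluster ω c) *
          SQ.indicator 1 (openEdgeCluster ω a) = (E ∩ Q).indicator 1 ω := by
    intro ω
    rw [hSE, hSQ, knLemma3i_indicator_upClosure_openEdgeCluster hE ω,
      rl3_indicator_downClosure_openEdgeCluster hQ ω]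
    exact (congrFun (Set.inter_indicator_one (s := E) (t := Q) (M₀ := ℝ)) ω).symm
  simp only [connIndicatorFn_openEdgeCluster, hg, hD, neg_mul, integral_neg, mul_neg, neg_mul]
    at key
  rw [show (fun ω : BondConfig (Fin n) => (openConn a b).indicator (1 : BondConfig (Fin n) → ℝ) ω *
        (E ∩ Q).indicator 1 ω) = (openConn a b ∩ (E ∩ Q)).indicator 1 from
      funext fun ω => (congrFun (Set.inter_indicator_one (s := openConn a b)
        (t := E ∩ Q) (M₀ := ℝ)) ω).symm] at key
  rw [setIntegral_indicator (hma.inter hmEQ), setIntegral_indicator hma,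
    setIntegral_indicator hmEQ] at key
  simp only [Pi.one_apply, setIntegral_const, smul_eq_mul, mul_one, Measure.real] at key ⊢
  linarith

/-- **Restricted (two-sided, signed) Kozma–Nitzan Lemma 3.**  For vertices `a, c, b`,
`D = {a ↮ c}`, an increasing event `E` determined by the open edge cluster of `c` and a
decreasing event `Q` determined by the open edge cluster of `a`:
`μ(D) · (μ({a↔b} ∩ (E ∩ Q)) − μ({c↔b} ∩ (E ∩ Q))) ≤ μ(D ∩ (E ∩ Q)) · (μ(a↔b) − μ(c↔b))`.
Proof: off `D` the events `{a ↔ b}` and `{c ↔ b}` coincide; on `D`, `rl3_loser` and `rl3_winner`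
(BHK 2006 Thm 1.5 twice); subtract.
[cite: KozmaNitzan2024, Lemma 3 (i),(ii) p. 6; VandenbergHaggstromKahn2005, Thm. 1.5] -/
theorem restrictedLemma3 (w : Sym2 (Fin n) → unitInterval) (a c b : Fin n)
    (E Q : Set (BondConfig (Fin n)))
    (hE : ∀ ω ω', ω ∈ E → openEdgeCluster ω c ⊆ openEdgeCluster ω' c → ω' ∈ E)
    (hQ : ∀ ω ω', ω ∈ Q → openEdgeCluster ω' a ⊆ openEdgeCluster ω a → ω' ∈ Q) :
    (prodBernoulli w).real (openConn a c)ᶜ *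
        ((prodBernoulli w).real (openConn a b ∩ (E ∩ Q)) -
          (prodBernoulli w).real (openConn c b ∩ (E ∩ Q))) ≤
      (prodBernoulli w).real ((openConn a c)ᶜ ∩ (E ∩ Q)) *
        ((prodBernoulli w).real (openConn a b) - (prodBernoulli w).real (openConn c b)) := by
  set μ := prodBernoulli w with hμ
  rcases eq_or_ne a c with hac | hac
  · subst hac
    have hD : ((openConn a a)ᶜ : Set (BondConfig (Fin n))) = ∅ := by
      ext ω
      simp only [Set.mem_compl_iff, Set.mem_empty_iff_false, iff_false, not_not]
      exact SimpleGraph.Reachable.refl _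
    simp [hD]
  have hDm : MeasurableSet ((openConn a c)ᶜ : Set (BondConfig (Fin n))) :=
    MeasurableSet.of_discrete
  -- off `D` the two events agree
  have hagree : ∀ F : Set (BondConfig (Fin n)),
      (openConn a b ∩ F) \ (openConn a c)ᶜ = (openConn c b ∩ F) \ (openConn a c)ᶜ := by
    intro F
    ext ω
    simp only [Set.mem_sdiff, Set.mem_inter_iff, Set.mem_compl_iff, not_not]
    constructor
    · rintro ⟨⟨h1, hF⟩, h2⟩
      exact ⟨⟨SimpleGraph.Reachable.trans (SimpleGraph.Reachable.symm h2) h1, hF⟩, h2⟩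
    · rintro ⟨⟨h1, hF⟩, h2⟩
      exact ⟨⟨SimpleGraph.Reachable.trans h2 h1, hF⟩, h2⟩
  have hs1 := measureReal_inter_add_sdiff (μ := μ) (s := openConn a b) hDm
  have hs2 := measureReal_inter_add_sdiff (μ := μ) (s := openConn c b) hDm
  have hs1Q := measureReal_inter_add_sdiff (μ := μ) (s := openConn a b ∩ (E ∩ Q)) hDm
  have hs2Q := measureReal_inter_add_sdiff (μ := μ) (s := openConn c b ∩ (E ∩ Q)) hDm
  have he : μ.real (openConn a b \ (openConn a c)ᶜ) = μ.real (openConn c b \ (openConn a c)ᶜ) := by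
    have h := hagree Set.univ
    simp only [Set.inter_univ] at h
    rw [h]
  have heQ : μ.real ((openConn a b ∩ (E ∩ Q)) \ (openConn a c)ᶜ) =
      μ.real ((openConn c b ∩ (E ∩ Q)) \ (openConn a c)ᶜ) := by rw [hagree (E ∩ Q)]
  rw [Set.inter_comm (openConn a b) (openConn a c)ᶜ] at hs1
  rw [Set.inter_comm (openConn c b) (openConn a c)ᶜ] at hs2
  rw [Set.inter_comm (openConn a b ∩ (E ∩ Q)) (openConn a c)ᶜ] at hs1Q
  rw [Set.inter_comm (openConn c b ∩ (E ∩ Q)) (openConn a c)ᶜ] at hs2Q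
  -- BHK Thm 1.5 twice, with `D = {c ↮ a} = {a ↮ c}`
  have hcomm : (openConn c a : Set (BondConfig (Fin n))) = openConn a c :=
    Set.ext fun _ => ⟨fun h => SimpleGraph.Reachable.symm h, fun h => SimpleGraph.Reachable.symm h⟩
  have hI := rl3_winner w c a b E Q hE hQ hac.symm
  have hII := rl3_loser w c a b E Q hE hQ hac.symm
  rw [hcomm] at hI hII
  have key : μ.real (openConn a c)ᶜ *
        (μ.real ((openConn a c)ᶜ ∩ (openConn a b ∩ (E ∩ Q))) -
          μ.real ((openConn a c)ᶜ ∩ (openConn c b ∩ (E ∩ Q)))) ≤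
      μ.real ((openConn a c)ᶜ ∩ (E ∩ Q)) *
        (μ.real ((openConn a c)ᶜ ∩ openConn a b) - μ.real ((openConn a c)ᶜ ∩ openConn c b)) := by
    have h1 : μ.real (openConn a c)ᶜ * μ.real ((openConn a c)ᶜ ∩ (openConn a b ∩ (E ∩ Q))) ≤
        μ.real ((openConn a c)ᶜ ∩ openConn a b) * μ.real ((openConn a c)ᶜ ∩ (E ∩ Q)) := hII
    have h2 : μ.real ((openConn a c)ᶜ ∩ openConn c b) * μ.real ((openConn a c)ᶜ ∩ (E ∩ Q)) ≤
        μ.real (openConn a c)ᶜ * μ.real ((openConn a c)ᶜ ∩ (openConn c b ∩ (E ∩ Q))) := hI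
    nlinarith [h1, h2]
  have hdiffQ : μ.real (openConn a b ∩ (E ∩ Q)) - μ.real (openConn c b ∩ (E ∩ Q)) =
      μ.real ((openConn a c)ᶜ ∩ (openConn a b ∩ (E ∩ Q))) -
        μ.real ((openConn a c)ᶜ ∩ (openConn c b ∩ (E ∩ Q))) := by linarith
  have hdiff : μ.real (openConn a b) - μ.real (openConn c b) =
      μ.real ((openConn a c)ᶜ ∩ openConn a b) - μ.real ((openConn a c)ᶜ ∩ openConn c b) := by
    linarith
  rw [hdiffQ, hdiff]
  exact key

/-- **Restricted Lemma 3, consequence.**  If `c` is at least as reliable as `a`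
(`μ(a↔b) ≤ μ(c↔b)`), then for every increasing `E` determined by the open edge cluster of `c` and
every decreasing `Q` determined by the open edge cluster of `a`:
`μ({a↔b} ∩ (E ∩ Q)) ≤ μ({c↔b} ∩ (E ∩ Q))`.
[cite: KozmaNitzan2024, Lemma 3 p. 6; VandenbergHaggstromKahn2005, Thm. 1.5] -/
theorem restrictedLemma3_of_le (w : Sym2 (Fin n) → unitInterval) (a c b : Fin n)
    (E Q : Set (BondConfig (Fin n)))
    (hE : ∀ ω ω', ω ∈ E → openEdgeCluster ω c ⊆ openEdgeCluster ω' c → ω' ∈ E)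
    (hQ : ∀ ω ω', ω ∈ Q → openEdgeCluster ω' a ⊆ openEdgeCluster ω a → ω' ∈ Q)
    (hle : (prodBernoulli w).real (openConn a b) ≤ (prodBernoulli w).real (openConn c b)) :
    (prodBernoulli w).real (openConn a b ∩ (E ∩ Q)) ≤
      (prodBernoulli w).real (openConn c b ∩ (E ∩ Q)) := by
  have h := restrictedLemma3 w a c b E Q hE hQ
  have hq : 0 ≤ (prodBernoulli w).real ((openConn a c)ᶜ ∩ (E ∩ Q)) := measureReal_nonneg
  have hrhs : (prodBernoulli w).real ((openConn a c)ᶜ ∩ (E ∩ Q)) *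
      ((prodBernoulli w).real (openConn a b) - (prodBernoulli w).real (openConn c b)) ≤ 0 :=
    mul_nonpos_of_nonneg_of_nonpos hq (by linarith)
  by_cases hD : 0 < (prodBernoulli w).real (openConn a c)ᶜ
  · nlinarith [h, hrhs, hD]
  · -- `μ(D) = 0`: the `D`-parts vanish and the off-`D` parts agree
    have hD0 : (prodBernoulli w).real (openConn a c)ᶜ = 0 :=
      le_antisymm (not_lt.1 hD) measureReal_nonneg
    have hDm : MeasurableSet ((openConn a c)ᶜ : Set (BondConfig (Fin n))) :=
      MeasurableSet.of_discrete
    have hagree : (openConn a b ∩ (E ∩ Q)) \ (openConn a c)ᶜ =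
        (openConn c b ∩ (E ∩ Q)) \ (openConn a c)ᶜ := by
      ext ω
      simp only [Set.mem_sdiff, Set.mem_inter_iff, Set.mem_compl_iff, not_not]
      constructor
      · rintro ⟨⟨h1, hF⟩, h2⟩
        exact ⟨⟨SimpleGraph.Reachable.trans (SimpleGraph.Reachable.symm h2) h1, hF⟩, h2⟩
      · rintro ⟨⟨h1, hF⟩, h2⟩
        exact ⟨⟨SimpleGraph.Reachable.trans h2 h1, hF⟩, h2⟩
    have hs1 := measureReal_inter_add_sdiff (μ := prodBernoulli w)
      (s := openConn a b ∩ (E ∩ Q)) hDm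
    have hs2 := measureReal_inter_add_sdiff (μ := prodBernoulli w)
      (s := openConn c b ∩ (E ∩ Q)) hDm
    have hz1 : (prodBernoulli w).real ((openConn a b ∩ (E ∩ Q)) ∩ (openConn a c)ᶜ) = 0 :=
      le_antisymm (hD0 ▸ measureReal_mono Set.inter_subset_right) measureReal_nonneg
    have hz2 : 0 ≤ (prodBernoulli w).real ((openConn c b ∩ (E ∩ Q)) ∩ (openConn a c)ᶜ) :=
      measureReal_nonneg
    rw [hagree] at hs1
    linarith

end

end Summit.CriticalPhenomena.PercolationContinuityZ3.Theorems
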